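import Literature.NumberTheory.GelbartRogawski1991.LocalSplittingIsometricCriterion
import Literature.NumberTheory.GelbartRogawski1991.LocalDoubledUnitaryBetaUnitary
import Literature.NumberTheory.GelbartRogawski1991.LocalUnitarySplittingsCM
import Literature.RepresentationTheory.HeisenbergGroup.SchrodingerPiIsometricImplementers
import Literature.NumberTheory.Automorphic.SchwartzBruhatL2NormDirectSum
import HarnessLib

/-!
# The tree's local Weil representations are UNITARY: the Leray–Rao section, `ω_v = β⁻¹ · r ∘ ι_v`, and the
# undoubled CM family `finLocalSplittingsCM` are `L²`-isometric at every finite place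

Topic `NumberTheory/GelbartRogawski1991`; namespace
`Literature.NumberTheory.GelbartRogawski1991.UnitaryDualPair.LocalSplitting`.  KERNEL ONLY: theorems; no definition,
no named fact, no `sorry`.  Assembly of:
`LocalSplittingIsometricCriterion.lean` (isometric implementers `+ |β| = 1 ⇒ ω_v` isometric; `|c_r| = 1`, `Sp` perfect),
`HeisenbergGroup/SchrodingerPiIsometricImplementers.lean` (every `g ∈ Sp(𝕎_v)` HAS an `L²`-isometric implementer —
Levi: module `|det|`, unipotent: unimodular multiplier, Weyl: Plancherel, [Weil1964, n° 13]),
`LocalDoubledUnitaryBetaUnitary.lean` (`|β| = 1` for the tree's data, [Kudla1994, Thm 3.1]) and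
`Automorphic/SchwartzBruhatL2NormDirectSum.lean` (stripping an isometry off `f₁ ⊠ f₂`).

* §1 `LocalSplittingDatum.l2NormSq_r` — every operator of the Leray–Rao section `r` of a local splitting datum is
  `L²(μ'^N)`-isometric on `𝒮(F_vᴺ)` (`μ'` any Haar measure on `F_v`); `isL2Isometric_localOmega_of_norm_beta` — so is
  `ω_v = β⁻¹ · r ∘ ι_v` as soon as `|β| = 1`;
* §2 `isL2Isometric_localOmega_localSplittingDatumCM` — the doubled CM datum (`χ` a unitary Hecke character);
* §3 `isL2Isometric_toRep_comp_localSplittingCMWith` — the UNDOUBLED splitting of `U(J)(L⁺_v)`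
  (`ω(s(g ⊕ 1))(f₁ ⊠ f₂) = ω(g) f₁ ⊠ f₂`, tree `toRep_undoubleLoc_boxSB`);
* §4 **`FinLocalSplittings.isL2Isometric_omegaLoc_finLocalSplittingsCM`** — the family `𝓢 = finLocalSplittingsCM` of the
  Hodge/COR-CM cell: `𝓢.omegaLoc v` is `L²`-isometric at EVERY finite place `v`.

Consequence (with `Liu2021/LemD1DataOfPlaceIsometric.lean`): the per-place cite `hD1` — [Liu2021, App. D Lem. D.1 (1)]
AS PRINTED read at the tree's family — has the same truth value at every `L²`-isometric (unitary) family of local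
splittings over `ι_v`, at split and non-split places alike; what remains of the object match (om1) is only the
identification of the tree's Schrödinger model / metaplectic cover with [Liu2021]'s `ω(ε)` on `Mp(V_ε)`.
Nothing of [GelbartRogawski1991], [Kudla1994], [Liu2021] is asserted.

## References
* [Weil1964] A. Weil, Acta Math. 111 (1964), Chap. I n° 13.
* [Kudla1994] S. S. Kudla, Israel J. Math. 87 (1994), Thm 3.1.
* [GelbartRogawski1991] S. Gelbart, J. Rogawski, Invent. Math. 105 (1991), §3.1 Prop. 3.1.1 p. 455.
* [MoeglinVignerasWaldspurger1987] C. Mœglin, M.-F. Vignéras, J.-L. Waldspurger, LNM 1291 (1987), Chap. 2 II.1–II.2.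
-/

set_option autoImplicit false

noncomputable section

open NumberField IsDedekindDomain _root_.MeasureTheory Matrix
open Literature.RepresentationTheory.HeisenbergGroup
open Literature.NumberTheory.Automorphic Literature.NumberTheory.Weil1964
open Literature.NumberTheory.GaloisRepresentations Literature.RepresentationTheory.HarrisKudlaSweet1996

namespace Literature.NumberTheory.GelbartRogawski1991.UnitaryDualPair.LocalSplitting

/-! ## §1 Any local splitting datum: `r` and `β⁻¹ · r ∘ ι` are `L²`-isometric -/

section Datum

variable {F : Type} [Field F] [NumberField F] {E : Type} [Field E] [NumberField E] [Algebra F E]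
  [Algebra.IsQuadraticExtension F E] {c : E ≃ₐ[F] E} {N : ℕ} {δ : E} {hcδ : c δ = -δ} {hδ : δ ≠ 0} {d : F}
  {hd : δ * δ = algebraMap F E d} {T : Matrix (Fin N) (Fin N) F} {hT : T.IsSymm} {hTd : IsUnit T.det}
  {J : Matrix (Fin N) (Fin N) E} {hJ : J = T.map (algebraMap F E)} {v : HeightOneSpectrum (𝓞 F)}
  [MeasurableSpace (v.adicCompletion F)] [BorelSpace (v.adicCompletion F)]
  {μ : Measure (v.adicCompletion F)} [μ.IsAddHaarMeasure]
  {ℓ : Submodule (v.adicCompletion F) ((Fin N → v.adicCompletion F) × (Fin N → v.adicCompletion F))}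
  {hℓ : LinearMap.BilinForm.orthogonal (alt (polar (localPairing F N T v))) ℓ = ℓ}
  (μ' : Measure (v.adicCompletion F)) [μ'.IsAddHaarMeasure]

include hTd in
/-- **every `g ∈ Sp(𝕎_v)` has an `L²(μ'^N)`-isometric implementer on the tree's local Schrödinger model `𝒮(F_vᴺ)`**
(`HeisenbergGroup/SchrodingerPiIsometricImplementers.lean` at `F_v`, Gram matrix `𝕋_v`). [cite: Weil1964, Chap. I n° 13] -/
theorem exists_isometric_implementer_localSchrodinger (g : LocalSp F N T v) :
    ∃ M : SchwartzBruhat (Fin N → v.adicCompletion F) ≃ₗ[ℂ] SchwartzBruhat (Fin N → v.adicCompletion F),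
      Implements (localSchrodinger F N T v) (ofSymplectic _ g) M ∧
        ∀ Φ, SchwartzBruhat.l2NormSq (Measure.pi fun _ : Fin N => μ') (M Φ) =
          SchwartzBruhat.l2NormSq (Measure.pi fun _ : Fin N => μ') Φ := by
  haveI := secondCountableTopology_adicCompletion F v
  obtain ⟨m, hm⟩ := (isContinuousNontrivial_adeleAddCharAt F v).exists_hasConductorExp
  exact exists_isometric_implementer_gram (localGram F N T v)
    (UnitaryGroup.isUnit_det_map (algebraMap F (v.adicCompletion F)) hTd)
    (isLocallyConstant_of_isContinuousNontrivial (isContinuousNontrivial_adeleAddCharAt F v))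
    (continuous_toLinearMap₂'_left (localGram F N T v)) μ' (isContinuousNontrivial_adeleAddCharAt F v) hm g

/-- **the Leray–Rao section of a local splitting datum consists of `L²(μ'^N)`-isometries** (`μ'` any Haar measure on
`F_v`). [cite: Weil1964, Chap. I n° 13] [cite: MoeglinVignerasWaldspurger1987, Chap. 2 II.2] -/
theorem LocalSplittingDatum.l2NormSq_r (D : LocalSplittingDatum F E c N hcδ hδ hd T hT hTd hJ v μ ℓ hℓ)
    (g : LocalSp F N T v) (Φ : SchwartzBruhat (Fin N → v.adicCompletion F)) :
    SchwartzBruhat.l2NormSq (Measure.pi fun _ : Fin N => μ') (D.r g Φ) =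
      SchwartzBruhat.l2NormSq (Measure.pi fun _ : Fin N => μ') Φ := by
  haveI := secondCountableTopology_adicCompletion F v
  exact D.l2NormSq_r_apply (Measure.pi fun _ : Fin N => μ')
    (exists_isometric_implementer_localSchrodinger (hTd := hTd) μ') g Φ

/-- **`ω_v = β⁻¹ · r ∘ ι_v` is `L²(μ'^N)`-isometric as soon as `|β| = 1`.** [cite: Weil1964, Chap. I n° 13] [cite: Kudla1994, Thm 3.1] -/
theorem LocalSplittingDatum.isL2Isometric_localOmega_of_norm_beta
    (D : LocalSplittingDatum F E c N hcδ hδ hd T hT hTd hJ v μ ℓ hℓ)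
    (hβ : ∀ g : UnitaryGroup.localPi E c N J v, ‖((D.beta g : ℂˣ) : ℂ)‖ = 1) :
    D.localOmega.IsL2Isometric (Measure.pi fun _ : Fin N => μ') := by
  haveI := secondCountableTopology_adicCompletion F v
  exact D.isL2Isometric_localOmega (Measure.pi fun _ : Fin N => μ')
    (exists_isometric_implementer_localSchrodinger (hTd := hTd) μ') hβ

end Datum

/-! ## §2–§4 The CM data: doubled datum, undoubled splitting, the family `finLocalSplittingsCM` -/

section CM

variable (L : Type) [Field L] [NumberField L] [IsCMField L] (n : ℕ) {T₀ : Matrix (Fin n) (Fin n) (maximalRealSubfield L)}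
  (hT₀ : T₀.IsSymm) (hT₀d : IsUnit T₀.det) {J : Matrix (Fin n) (Fin n) L}
  (hJ : J = T₀.map (algebraMap (maximalRealSubfield L) L)) (χ : HeckeCharacter L) (hχ : IsSplittingChar L 1 χ)
  (v : HeightOneSpectrum (𝓞 (maximalRealSubfield L)))

section WithMeasure

variable [MeasurableSpace (v.adicCompletion (maximalRealSubfield L))] [BorelSpace (v.adicCompletion (maximalRealSubfield L))]
  (μ : Measure (v.adicCompletion (maximalRealSubfield L))) [μ.IsAddHaarMeasure]
  (μ' : Measure (v.adicCompletion (maximalRealSubfield L))) [μ'.IsAddHaarMeasure]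

/-- **the local Weil representation of the doubled CM datum `U(T₀ ⊕ −T₀)(L⁺_v)` is `L²`-isometric** (`χ` unitary).
[cite: Kudla1994, Thm 3.1] [cite: Weil1964, Chap. I n° 13] -/
theorem isL2Isometric_localOmega_localSplittingDatumCM (hχu : χ.IsUnitary)
    {JD : Matrix (Fin (n + n)) (Fin (n + n)) L}
    (hJD : JD = (gramD (maximalRealSubfield L) n T₀).map (algebraMap (maximalRealSubfield L) L)) :
    (localSplittingDatumCM L v μ n hT₀ hT₀d hJD χ hχ).localOmega.IsL2Isometric (Measure.pi fun _ : Fin (n + n) => μ') :=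
  (localSplittingDatumCM L v μ n hT₀ hT₀d hJD χ hχ).isL2Isometric_localOmega_of_norm_beta μ'
    (norm_beta_localSplittingDatumCM_eq_one n L v μ hT₀ hT₀d hJD χ hχ hχu)

/-- **the UNDOUBLED local Weil representation of `U(J)(L⁺_v)` along `localSplittingCMWith` is `L²`-isometric**:
`ω(s(g ⊕ 1))(f₁ ⊠ f₂) = ω(g) f₁ ⊠ f₂` with the doubled side isometric and `f₂ = 1_{𝒪ⁿ} ≠ 0`.
[cite: MoeglinVignerasWaldspurger1987, Chap. 2 II.1 Rem. (6)] [cite: GelbartRogawski1991, §3.1 Prop. 3.1.1 p. 455 L1–3] -/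
theorem isL2Isometric_toRep_comp_localSplittingCMWith (hχu : χ.IsUnitary) :
    Representation.IsL2Isometric (Measure.pi fun _ : Fin n => μ')
      ((MpPsi.toRep (localSchrodinger (maximalRealSubfield L) n T₀ v)).comp
        (localSplittingCMWith L n hT₀ hT₀d hJ χ hχ v μ)) := by
  intro g f₁
  haveI : Nontrivial (SchwartzBruhat (Fin n → v.adicCompletion (maximalRealSubfield L))) := nontrivial_schwartzBruhat_pi
  obtain ⟨f₂, hf₂⟩ := exists_ne (0 : SchwartzBruhat (Fin n → v.adicCompletion (maximalRealSubfield L)))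
  have hA := isL2Isometric_localOmega_localSplittingDatumCM L n hT₀ hT₀d χ hχ v μ μ' hχu
    (JD := (gramD (maximalRealSubfield L) n T₀).map (algebraMap (maximalRealSubfield L) L)) rfl
  -- the doubled operator at `g ⊕ 1` (an isometry) and the undoubling identity on products `f ⊠ f₂`
  have hA' : ∀ Φ, SchwartzBruhat.l2NormSq (Measure.pi fun _ : Fin (n + n) => μ')
      (MpPsi.toRep _ ((localSplittingDatumCM L v μ n hT₀ hT₀d rfl χ hχ).localSplitting
        (inlLoc (maximalRealSubfield L) L (IsCMField.complexConj L) v n hJ rfl g)) Φ) =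
        SchwartzBruhat.l2NormSq (Measure.pi fun _ : Fin (n + n) => μ') Φ :=
    fun Φ => hA (inlLoc (maximalRealSubfield L) L (IsCMField.complexConj L) v n hJ rfl g) Φ
  have hAB := fun f : SchwartzBruhat (Fin n → v.adicCompletion (maximalRealSubfield L)) =>
    toRep_undoubleLoc_boxSB (maximalRealSubfield L) L (IsCMField.complexConj L) v n hJ rfl
      (complexConj_imagUnit L) (imagUnit_ne_zero L) (imagUnit_mul_self L) hT₀ hT₀d
      (localSplittingDatumCM L v μ n hT₀ hT₀d rfl χ hχ).localSplitting
      (fun g' => (localSplittingDatumCM L v μ n hT₀ hT₀d rfl χ hχ).proj_localSplitting g') g f f₂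
  exact l2NormSq_eq_of_boxSB_linear (v.adicCompletion (maximalRealSubfield L)) μ' (e₂ n) _ hA' _ hf₂ hAB f₁

end WithMeasure

/-- **THE FAMILY `finLocalSplittingsCM` IS UNITARY AT EVERY FINITE PLACE**: for every finite place `v` of `L⁺`, every
Borel structure and every Haar measure `μ'` on `L⁺_v`, the local Weil representation `𝓢.omegaLoc v` of `U(J)(L⁺_v)`
on `𝒮((L⁺_v)ⁿ)` preserves `‖·‖²_{L²(μ'ⁿ)}` (`χ` a unitary Hecke character of the CM field `L`).
[cite: Weil1964, Chap. I n° 13] [cite: GelbartRogawski1991, §3.1 Prop. 3.1.1 p. 455 L1–3] -/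
theorem FinLocalSplittings.isL2Isometric_omegaLoc_finLocalSplittingsCM (hχu : χ.IsUnitary)
    [inst : MeasurableSpace (v.adicCompletion (maximalRealSubfield L))] [BorelSpace (v.adicCompletion (maximalRealSubfield L))]
    (μ' : Measure (v.adicCompletion (maximalRealSubfield L))) [μ'.IsAddHaarMeasure] :
    ((finLocalSplittingsCM L n hT₀ hT₀d hJ χ hχ).omegaLoc v).IsL2Isometric (Measure.pi fun _ : Fin n => μ') := by
  have h : inst = borel _ := BorelSpace.measurable_eq
  subst h
  letI : MeasurableSpace (v.adicCompletion (maximalRealSubfield L)) := borel _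
  intro g f
  exact isL2Isometric_toRep_comp_localSplittingCMWith L n hT₀ hT₀d hJ χ hχ v Measure.addHaar μ' hχu g f

end CM

end Literature.NumberTheory.GelbartRogawski1991.UnitaryDualPair.LocalSplitting

end
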